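import Summits.CriticalPhenomena.SAWScalingLimit.Theorems.SAWDevelopingMapHexTransferGMHexDictionaryCurves

/-!
# The `π/3` dictionary at law level: `stub_gmHexDictionary` (line `yb-relay`, crux `HexTransfer`)

Stub `stub_gmHexDictionary` of the checked skeleton of the line `yb-relay` for the crux `HexTransfer`
(stmt-CriticalPhenomena-14221): **the exact "Glazman–Manolescu walk at `Θ ≡ π/3` = hexagonal SAW"
dictionary at the level of the finite-domain laws** (A. Glazman, I. Manolescu, arXiv:1708.00395, §1
p. 3: "if `Θ` is the constant sequence equal to `π/3` … the self-avoiding walk model described above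
becomes that on the hexagonal lattice dual to the triangular one, with weight `(1/√(2+√2))^{|γ|}`",
and Fig. 2). For boundary mid-edges `a ≠ b` of `Ω_δ = meshFaces (π/3) Ω δ`, the critical
Yang–Baxter law `ybLaw (π/3) Ω δ 1 a b` is the push-forward of Duminil-Copin–Smirnov's critical
hexagonal law `hexSAWLaw (faceDomain Ω δ a) δ (bdryVertex a) (bdryVertex b)` along the map
`φ = hexToYB` of `…GMHexDictionaryChart`, and `φ` moves the drawn curves by at most `2δ`
(`…GMHexDictionaryCurves`).

Proof of the law identity (`map_hexSAWLaw_eq_ybLaw`): both measures are sums of weighted Dirac masses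
on discrete spaces; `φ` is injective, `w_{π/3}(φ γ) · 1^{|φ γ|} = x_c^{ℓ(γ)}` (`weight_hexToYB`), and
the walks outside the image of `φ` are exactly the walks of weight `w₂(π/3) = 0`
(`exists_hexToYB_eq`), so the weight measures correspond under `φ` (`map_hexSAWWeight_eq_ybWeight`,
a reindexing of `tsum`s, `Function.Injective.tsum_eq`) and so do their total masses and
normalisations.
-/

noncomputable section

namespace Summit.CriticalPhenomena.SAWScalingLimit.Cruxes.HexTransfer.YbRelay

open MeasureTheory Filter Topology Set
open scoped ENNReal
open Complex (I I_ne_zero)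
open Literature.Probability.RandomPlanarGeometry
open Literature.Probability.RandomPlanarGeometry.SAW
open Literature.Probability.RandomPlanarGeometry.SAW.YangBaxter
open Literature.Probability.LatticeModels (Site HexVertex hexGraph hexCenter)

/-! ### Push-forward of a discrete weighted sum of Dirac masses along an injection -/

/-- **Reindexing a sum of weighted Dirac masses along an injection**: if `φ : β → α` is injective,
`d = c ∘ φ`, and `c` vanishes off the range of `φ`, then `φ_* (Σ_b d(b) δ_b) = Σ_a c(a) δ_a` (discrete
σ-algebras). [folklore] -/
theorem map_sum_smul_dirac_eq {α β : Type*} [MeasurableSpace α] [MeasurableSpace β]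
    (hα : ‹MeasurableSpace α› = ⊤) (hβ : ‹MeasurableSpace β› = ⊤) (φ : β → α) (hφ : Function.Injective φ)
    (c : α → ℝ≥0∞) (d : β → ℝ≥0∞) (hcd : ∀ b, d b = c (φ b)) (hc : ∀ a, c a ≠ 0 → a ∈ Set.range φ) :
    (Measure.sum fun b => d b • Measure.dirac b).map φ = Measure.sum fun a => c a • Measure.dirac a := by
  have mα : ∀ s : Set α, MeasurableSet s := fun s => by subst hα; exact MeasurableSpace.measurableSet_top
  have mβ : ∀ s : Set β, MeasurableSet s := fun s => by subst hβ; exact MeasurableSpace.measurableSet_top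
  have mφ : Measurable φ := fun s _ => mβ _
  refine Measure.ext fun s _ => ?_
  rw [Measure.map_apply mφ (mα s), Measure.sum_apply _ (mβ _), Measure.sum_apply _ (mα s)]
  simp only [Measure.smul_apply, smul_eq_mul, Measure.dirac_apply' _ (mα s), Measure.dirac_apply' _ (mβ _)]
  have h1 : ∀ b, d b * (φ ⁻¹' s).indicator 1 b = s.indicator c (φ b) := by
    intro b
    by_cases hb : φ b ∈ s
    · rw [indicator_of_mem (show b ∈ φ ⁻¹' s from hb), indicator_of_mem hb, hcd]; simp
    · rw [indicator_of_notMem (show b ∉ φ ⁻¹' s from hb), indicator_of_notMem hb]; simp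
  have h2 : ∀ a, c a * s.indicator 1 a = s.indicator c a := by
    intro a
    by_cases ha : a ∈ s
    · rw [indicator_of_mem ha, indicator_of_mem ha]; simp
    · rw [indicator_of_notMem ha, indicator_of_notMem ha]; simp
  simp only [h1, h2]
  exact hφ.tsum_eq fun a ha => hc a fun h => ha (by simp [h])

/-- Under the same hypotheses the total masses agree: `Σ_b d(b) = Σ_a c(a)`. [folklore] -/
theorem tsum_eq_tsum_of_injective {α β : Type*} (φ : β → α) (hφ : Function.Injective φ)
    (c : α → ℝ≥0∞) (d : β → ℝ≥0∞) (hcd : ∀ b, d b = c (φ b)) (hc : ∀ a, c a ≠ 0 → a ∈ Set.range φ) :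
    ∑' b, d b = ∑' a, c a := by
  simp only [hcd]
  exact hφ.tsum_eq fun a ha => hc a ha

/-! ### The law identity -/

section Law

variable {Ω : Set ℂ} {δ : ℝ} (hδ : δ ≠ 0) {a b : MidEdge} (ha : IsBdryEdge (meshFaces third Ω δ) a)
  (hb : IsBdryEdge (meshFaces third Ω δ) b) (hab : a ≠ b)

/-- **The critical hexagonal weight measure of the face domain is carried by `φ` onto the critical
Yang–Baxter weight measure of `Ω_δ` at `Θ ≡ π/3`.** [cite: GlazmanManolescu2019, §1 p. 3, Fig. 2] -/
theorem map_hexSAWWeight_eq_ybWeight :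
    (hexSAWWeight (faceDomain Ω δ a) δ (bdryVertex (meshFaces third Ω δ) a) (bdryVertex (meshFaces third Ω δ) b)).map
      (hexToYB hδ ha hb hab) = ybWeight third Ω δ 1 a b := by
  refine map_sum_smul_dirac_eq rfl rfl _ (hexToYB_injective hδ ha hb hab) _ _ (fun γ => ?_) (fun γ hγ => ?_)
  · rw [weight_hexToYB, Real.one_rpow, mul_one]
  · refine exists_hexToYB_eq hδ ha hb hab γ fun h => hγ ?_
    rw [h, zero_mul, ENNReal.ofReal_zero]

include hδ ha hb hab in
/-- The partition functions agree: `Z_hex = Z_{π/3}`. [cite: GlazmanManolescu2019, §1 p. 3] -/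
theorem hexSAWWeight_univ_eq_ybWeight_univ :
    hexSAWWeight (faceDomain Ω δ a) δ (bdryVertex (meshFaces third Ω δ) a) (bdryVertex (meshFaces third Ω δ) b) univ =
      ybWeight third Ω δ 1 a b univ := by
  rw [← map_hexSAWWeight_eq_ybWeight hδ ha hb hab, Measure.map_apply (EmbDomainSAW.measurable_of_top _)
    MeasurableSet.univ, preimage_univ]

/-- **The law identity of the dictionary**: `ybLaw (π/3) Ω δ 1 a b = φ_* hexSAWLaw (faceDomain Ω δ a) δ
(bdryVertex a) (bdryVertex b)`. [cite: GlazmanManolescu2019, §1 p. 3, Fig. 2] -/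
theorem map_hexSAWLaw_eq_ybLaw :
    (hexSAWLaw (faceDomain Ω δ a) δ (bdryVertex (meshFaces third Ω δ) a) (bdryVertex (meshFaces third Ω δ) b)).map
      (hexToYB hδ ha hb hab) = ybLaw third Ω δ 1 a b := by
  rw [hexSAWLaw, embLaw, Measure.map_smul, ybLaw, ← hexSAWWeight_univ_eq_ybWeight_univ hδ ha hb hab,
    ← map_hexSAWWeight_eq_ybWeight hδ ha hb hab]

end Law

/-! ### The registered stub -/

/-- **Stub `stub_gmHexDictionary` of the line `yb-relay` (the exact `π/3` dictionary at law level,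
Glazman–Manolescu §1 p. 3 and Fig. 2).** For `δ > 0` and boundary mid-edges `a ≠ b` of
`Ω_δ = meshFaces (π/3) Ω δ`, there is a map `φ` from the self-avoiding walks of the canonical hexagonal
discretisation of the face domain `faceDomain Ω δ a`, between the boundary vertices of `a` and `b`,
to the Yang–Baxter walks of `Ω_δ` from `a` to `b`, such that the critical Yang–Baxter law at
`Θ ≡ π/3` is the push-forward along `φ` of the critical hexagonal law, and the drawn curve of `φ γ`
is `2δ`-close to the image under the similarity `S_δ z = i z − i δ/2` of the drawn curve of `γ`.
(`φ = hexToYB`; the hypothesis that some walk joins `a` to `b` is not needed.)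
[cite: GlazmanManolescu2019, §1 p. 3, Fig. 2] -/
theorem stub_gmHexDictionary : ∀ (Ω : Set ℂ) (δ : ℝ), 0 < δ → ∀ a b : MidEdge, a ≠ b → IsBdryEdge (meshFaces third Ω δ) a → IsBdryEdge (meshFaces third Ω δ) b → Nonempty (YangBaxterSAW third Ω δ a b) → ∃ φ : HexDomainSAW (faceDomain Ω δ a) δ (bdryVertex (meshFaces third Ω δ) a) (bdryVertex (meshFaces third Ω δ) b) → YangBaxterSAW third Ω δ a b, ybLaw third Ω δ 1 a b = (hexSAWLaw (faceDomain Ω δ a) δ (bdryVertex (meshFaces third Ω δ) a) (bdryVertex (meshFaces third Ω δ) b)).map φ ∧ ∀ γ, dist ((φ γ).curve third δ) (CurveClass.map (gmSimilarity δ : C(ℂ, ℂ)) γ.curve) ≤ 2 * δ := by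
  intro Ω δ hδ a b hab ha hb _
  exact ⟨hexToYB hδ.ne' ha hb hab, (map_hexSAWLaw_eq_ybLaw hδ.ne' ha hb hab).symm,
    dist_curve_hexToYB_le hδ ha hb hab⟩

end Summit.CriticalPhenomena.SAWScalingLimit.Cruxes.HexTransfer.YbRelay

end
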